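import Summits.HodgeConjecture.HodgeConjecture.Theses.NikulinTwinTransport
import Literature.AlgebraicGeometry.HodgeTheory.ChernCharacterBetti
import Literature.AlgebraicGeometry.Surfaces.K3Surface
import Literature.AlgebraicGeometry.HodgeTheory.GysinHodgeClassLiftProofs
import Literature.AlgebraicGeometry.HodgeTheory.ComplexGysinCorrespondence
import Literature.AlgebraicGeometry.HodgeTheory.RationalClassesRingChange
import Literature.AlgebraicGeometry.HodgeTheory.SupportedClassesHodgeConiveau
import Literature.AlgebraicGeometry.HodgeTheory.ComplexConjugation

/-!
# Crux `NikulinSerreCarrier`, line `neron-severi-intertwiner` — stub S2 `stub_kappaActionHodge`: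
# the intertwiner class of a vector bundle acts by a Hodge morphism (core, conditional on named facts)

Helper file for the crux item stmt-HodgeConjecture-14464 (route `NikulinTwinTransport`), serving the
registered stub `stub_kappaActionHodge` of the line skeleton
`Cruxes/NikulinSerreCarrier/Lines/neron-severi-intertwiner.lean`. For projective K3 surfaces `X, Y`,
a Chern character `C : ChernCharacterBetti` and a vector bundle `G` of rank `r` on `W = X ⊗ Y`, the
INTERTWINER CLASS `κ_G = ch₁(G) ∪ ch₁(G) − 2r·ch₂(G) ∈ H⁴(W(ℂ); ℂ)` acts on `H²` by
`y ↦ fst_*(snd^* y ∪ κ_G)` (`= HodgeTheory.corrAction μ hX hY rfl κ_G y`, `corrAction_apply` is `rfl`).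
The stub says: (i) this action is RATIONAL up to ONE non-zero complex scalar (absorbing the
orientation family `μ`), and (ii) it PRESERVES Hodge types `(i, j)`.

What is PROVED here (no named fact introduced, no `sorry`):

* `exists_smul_corrAction_isRationalClass` — for every rational class `γ ∈ H^{2e}((W ⊗ X)(ℂ))`
  there is ONE `u ≠ 0` with `u • γ_*(c)` rational for all rational `c` (pull-back and cup product
  preserve rational cocycles; `complexGysin μ` is `u' •` the rational Gysin homomorphism on rational
  classes, `complexGysin_ringChange_eq_smul_gysinMap`, Voisin I §7.3.2 / Fulton App. B (5)).
* `isOfHodgeType_corrAction` — for `γ` of type `(e, e)`, `γ_*` has bidegree `(e − dim X, e − dim X)`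
  on Hodge types, given Hodge models of `W ⊗ X` and `W` on which cup products add types (pull-back:
  `IsOfHodgeType.map_of_independent`; cup: `CupPreservesHodgeType`; Gysin:
  `isOfHodgeType_complexGysin_of_cupPreservesHodgeType`, Voisin I §7.3.2 with Lemma 7.30;
  independence of the model is the tree's THEOREM `hodgePQ_independent_of_hodgeModel_holds`).
* `isRationalClass_kappaClass` — `κ_G` is rational (`ChernCharacterBetti.isRationalClass_ch`).
* `isOfHodgeType_of_mem_algebraicClasses`, `isOfHodgeType_kappaClass` — algebraic classes are of
  type `(p, p)` granted Grothendieck's coniveau fact `Grothendieck1969_supportedClasses_le_hodgeConiveau`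
  (`Nᵖ H²ᵖ ⊆ H^{p,p}`); hence `κ_G`, built from the algebraic `chᵢ(G)`
  (`ChernCharacterBetti.ch_mem_algebraicClasses`), is of type `(2, 2)`.
* `kappaAction_rational` — half (i) of the stub's unfolded core, UNCONDITIONALLY.
* `kappaAction_hodgeType_of_facts` — half (ii), CONDITIONAL on the named facts
  `nonempty_hodgeModel` (a Hodge model of the fourfold `X ⊗ Y`), de Rham's theorem
  `Literature.NumberTheory.Transcendental.exists_deRhamIsoFamily` (cup products add Hodge types,
  `cupPreservesHodgeType_of_nonempty_hodgeModel`) and `Grothendieck1969_supportedClasses_le_hodgeConiveau`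
  (algebraic classes of `X ⊗ Y` are of type `(p, p)`), in the binder shape of
  `isOfHodgeType_complexGysin`.
* `kappaActionHodge_core_of_facts` — the stub's unfolded CORE verbatim, conditional on the same
  three named facts.

Why exactly these facts (status checked 2026-08-16, none has a `_holds`): the Hodge type of the
abstract Chern character `C.ch` is reachable ONLY through its algebraicity field
(`ch_mem_algebraicClasses : chᵢ(G) ∈ Nⁱ H²ⁱ = algebraicClasses`; the structure records no
`IsOfHodgeType` property by design), and "`Nᵖ H²ᵖ ⊆ H^{p,p}`" is Deligne's theorem, vendored in the
tree as `Grothendieck1969_supportedClasses_le_hodgeConiveau` (reductions: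
`Grothendieck1969_supportedClasses_le_hodgeConiveau_of_deRham` from Deligne 8.2.8 + projective
Hironaka + the two facts below; the same hypothesis is taken by the route's
`isOfHodgeType_oneOne_of_mem_algebraicClasses` in `NikulinTwinTransportRealMultiplicationSqrtTwoAlgebraic`);
a Hodge model of the FOURFOLD `X ⊗ Y` is not constructible from the K3 models of `X`, `Y` in the tree
(no product of Hodge models), whence `nonempty_hodgeModel`; and cup-compatibility of Hodge types on
`X ⊗ Y` and on `X` is the tree's theorem from de Rham's theorem `exists_deRhamIsoFamily` only. The
sharper intermediate `kappaAction_hodgeType_of_hodgeModel` takes instead a Hodge model `B` of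
`X ⊗ Y`, `CupPreservesHodgeType` on `X ⊗ Y` and on `X`, and the coniveau fact.

Not here: any discharge of the three named facts (the trust base of (ii)).
-/

noncomputable section

open scoped Manifold
open CategoryTheory MonoidalCategory CartesianMonoidalCategory
open Literature.AlgebraicGeometry
open Literature.AlgebraicGeometry.HodgeTheory
open Literature.AlgebraicTopology.SingularHomology
open Literature.NumberTheory.Transcendental (exists_deRhamIsoFamily)

namespace Summit.HodgeConjecture.HodgeConjecture.Theorems.NikulinSerreCarrier.NeronSeveriIntertwiner

/-! ### Small closure lemmas for Hodge types -/

variable {n : ℕ} {X : Motives.SchemeOver ℂ}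

/-- Classes of a fixed Hodge type `(p, q)` on a smooth projective `X` are closed under subtraction
(test both in one Hodge model, legitimately by `hodgePQ_independent_of_hodgeModel_holds`; the
pull-back to the model is linear and `H^{p,q}` is a subspace). -/
theorem isOfHodgeType_sub (hX : Motives.IsSmoothProjective n X) {k p q : ℕ} {a b : complexBetti X k}
    (ha : IsOfHodgeType n X k p q a) (hb : IsOfHodgeType n X k p q b) :
    IsOfHodgeType n X k p q (a - b) := by
  obtain ⟨A, hA⟩ := ha
  have hB := (hodgePQ_independent_of_hodgeModel_holds.isOfHodgeType_iff hX A).1 hb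
  exact ⟨A, by rw [map_sub]; exact Submodule.sub_mem _ hA hB⟩

/-- Classes of a fixed Hodge type `(p, q)` are closed under complex scalars. -/
theorem isOfHodgeType_smul {k p q : ℕ} {a : complexBetti X k} (ha : IsOfHodgeType n X k p q a)
    (t : ℂ) : IsOfHodgeType n X k p q (t • a) := by
  obtain ⟨A, hA⟩ := ha
  exact ⟨A, by rw [map_smul]; exact Submodule.smul_mem _ t hA⟩

/-- **Algebraic classes are of Hodge type `(p, p)`**, granted Grothendieck's coniveau fact
`Grothendieck1969_supportedClasses_le_hodgeConiveau` (`Nᵖ H²ᵖ` has Hodge coniveau `≥ p`, i.e. lies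
in `⨆_{a + b = 2p, a ≥ p, b ≥ p} H^{a,b} = H^{p,p}`; Grothendieck 1969 p. 300, Voisin I Prop. 11.20),
for `X` smooth projective with a Hodge model `A`. -/
theorem isOfHodgeType_of_mem_algebraicClasses (hG : Grothendieck1969_supportedClasses_le_hodgeConiveau)
    (hX : Motives.IsSmoothProjective n X) (A : HodgeModel n X) {p : ℕ} {c : complexBetti X (2 * p)}
    (hc : c ∈ algebraicClasses X p) : IsOfHodgeType n X (2 * p) p p c := by
  have h : A.pullback (2 * p) c ∈ A.hodgeConiveau (2 * p) p := hG hX A (2 * p) p ⟨c, hc, rfl⟩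
  have hle : A.hodgeConiveau (2 * p) p ≤ A.hodgePQ (2 * p) p p := by
    refine iSup_le fun a => iSup_le fun b => iSup_le fun hab => iSup_le fun ha => iSup_le fun hb => ?_
    obtain ⟨rfl, rfl⟩ : a = p ∧ b = p := by omega
    exact le_rfl
  exact ⟨A, hle h⟩

/-! ### The action of a class `γ` on a product: rationality up to one scalar, and Hodge types -/

section CorrAction

variable {m : ℕ} {W : Motives.SchemeOver ℂ}

/-- **`γ_*` is rational up to ONE non-zero scalar.** For smooth projective `W, X`, an orientation
family `μ` with Poincaré duality and a RATIONAL class `γ ∈ H^{2e}((W ⊗ X)(ℂ); ℂ)`, there is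
`u ∈ ℂ`, `u ≠ 0`, such that `u • γ_*(c) = u • pr_{W*}(pr_X^* c ∪ γ)` is rational for every rational
`c ∈ Hᵃ(X(ℂ); ℂ)`: pull-backs and cup products of rational classes are rational
(`IsRationalClass.map`, `.cup`), a rational class is `ι x` for the change of coefficients
`ι : H(–; ℚ) → H(–; ℂ)`, and `pr_{W*}(ι x) = u' • ι(rational Gysin of x)` with ONE `u' ≠ 0`
(`complexGysin_ringChange_eq_smul_gysinMap`, for `ℚ`-orientations of `(W ⊗ X)(ℂ)`, `W(ℂ)` with
Poincaré duality); `u = u'⁻¹`. In degrees above `2 dim (W ⊗ X)`, `pr_{W*} = 0`. -/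
theorem exists_smul_corrAction_isRationalClass (μ : OrientationFamily) (hμ : μ.HasPoincareDuality)
    (hW : Motives.IsSmoothProjective m W) (hX : Motives.IsSmoothProjective n X) {e a b : ℕ}
    (hab : a + 2 * e = b + 2 * n) {γ : complexBetti (W ⊗ X) (2 * e)} (hγ : IsRationalClass γ) :
    ∃ u : ℂ, u ≠ 0 ∧ ∀ c : complexBetti X a, IsRationalClass c →
      IsRationalClass (u • HodgeTheory.corrAction μ hW hX hab γ c) := by
  by_cases hdeg : a + 2 * e ≤ 2 * (m + n)
  · obtain ⟨νY⟩ := Motives.ComplexPoints.isOrientableOver ℚ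
      (Motives.IsSmoothProjective.tensor_holds hW hX)
    obtain ⟨νX, hνX⟩ := exists_ratOrientation_hasPoincareDuality hW
    obtain ⟨u, hu, hcomp⟩ := complexGysin_ringChange_eq_smul_gysinMap hμ
      (Motives.IsSmoothProjective.tensor_holds hW hX) hW (fst W X)
      (show a + 2 * e + (2 * (m + n) - (a + 2 * e)) = 2 * (m + n) by omega)
      (show b + (2 * (m + n) - (a + 2 * e)) = 2 * m by omega) νY νX hνX
    refine ⟨u⁻¹, inv_ne_zero hu, fun c hc ↦ ?_⟩
    have hz : IsRationalClass
        (cupProduct (rfl : a + 2 * e = a + 2 * e) (complexBetti.map (snd W X) a c) γ) :=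
      (hc.map _).cup _ hγ
    obtain ⟨x, hx⟩ := hz.exists_ringChange_eq
    rw [corrAction_apply, ← hx, hcomp x, smul_smul, inv_mul_cancel₀ hu, one_smul]
    exact isRationalClass_ringChange _
  · refine ⟨1, one_ne_zero, fun c _ ↦ ?_⟩
    rw [corrAction_apply, complexGysin_of_lt _ hW (fst W X) _ (by omega), LinearMap.zero_apply,
      smul_zero]
    exact IsRationalClass.zero

/-- **`γ_*` has bidegree `(e − dim X, e − dim X)` on Hodge types for `γ` of type `(e, e)`**
(Voisin I, §7.3.2: pull-back, cup product with a class of pure type and Gysin morphism are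
compatible with Hodge types). Hypotheses: Hodge models `B` of `W ⊗ X` and `A` of `W` on which cup
products add Hodge types (`CupPreservesHodgeType`); the model-independence of `H^{p,q}` is the
tree's theorem `hodgePQ_independent_of_hodgeModel_holds`. If `c ∈ Hᵃ(X(ℂ))` is of type `(p, q)`
then `γ_*(c) ∈ Hᵇ(W(ℂ))` is of type `(p', q')`, `p' + dim X = p + e`, `q' + dim X = q + e`. -/
theorem isOfHodgeType_corrAction (μ : OrientationFamily) (hW : Motives.IsSmoothProjective m W)
    (hX : Motives.IsSmoothProjective n X) (B : HodgeModel (m + n) (W ⊗ X)) (A : HodgeModel m W)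
    (hcB : CupPreservesHodgeType (m + n) (W ⊗ X)) (hcA : CupPreservesHodgeType m W) {e a b : ℕ}
    (hab : a + 2 * e = b + 2 * n) {γ : complexBetti (W ⊗ X) (2 * e)}
    (hγ : IsOfHodgeType (m + n) (W ⊗ X) (2 * e) e e γ) {p q p' q' : ℕ} (hp : p' + n = p + e)
    (hq : q' + n = q + e) {c : complexBetti X a} (hc : IsOfHodgeType n X a p q c) :
    IsOfHodgeType m W b p' q' (HodgeTheory.corrAction μ hW hX hab γ c) := by
  have hI := hodgePQ_independent_of_hodgeModel_holds
  have h1 : IsOfHodgeType (m + n) (W ⊗ X) a p q (complexBetti.map (snd W X) a c) :=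
    hc.map_of_independent hI (Motives.IsSmoothProjective.tensor_holds hW hX) hX B (snd W X)
  have h2 : IsOfHodgeType (m + n) (W ⊗ X) (a + 2 * e) (p + e) (q + e)
      (cupProduct (rfl : a + 2 * e = a + 2 * e) (complexBetti.map (snd W X) a c) γ) :=
    hcB rfl h1 hγ
  rw [corrAction_apply]
  exact isOfHodgeType_complexGysin_of_cupPreservesHodgeType hI μ
    (Motives.IsSmoothProjective.tensor_holds hW hX) hW B A hcB hcA (fst W X)
    (corrAction_degree m hab) (by omega) (by omega) h2

end CorrAction

/-! ### The intertwiner class `κ_G = ch₁(G) ∪ ch₁(G) − 2r·ch₂(G)` -/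

section Kappa

variable (C : ChernCharacterBetti)

/-- **`κ_G` is a rational class**: `chᵢ(G)` are rational (`ChernCharacterBetti.isRationalClass_ch`),
and rational classes are closed under cup products, rational scalars (`-2r`) and sums
(`a - (2r) • b = a + (-(2r)) • b`). -/
theorem isRationalClass_kappaClass (W : Motives.SchemeOver ℂ) (G : W.left.Modules)
    (hG : Motives.IsVectorBundle G) (r : ℕ) :
    IsRationalClass (cupProduct (rfl : 2 * 1 + 2 * 1 = 2 * 2) (C.ch W G 1) (C.ch W G 1) -
      (2 * (r : ℂ)) • C.ch W G 2) := by
  have h1 := C.isRationalClass_ch W G hG 1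
  have h3 : IsRationalClass ((-(2 * (r : ℂ))) • C.ch W G 2) := by
    have h := (C.isRationalClass_ch W G hG 2).smul (-(2 * r))
    rwa [Rat.cast_neg, Rat.cast_mul, Rat.cast_ofNat, Rat.cast_natCast] at h
  rw [sub_eq_add_neg, ← neg_smul]
  exact (h1.cup _ h1).add h3

/-- **`κ_G` is of Hodge type `(2, 2)`** on a smooth projective `W` with a Hodge model `B` on which
cup products add types, granted `Grothendieck1969_supportedClasses_le_hodgeConiveau`: `ch₁(G)`,
`ch₂(G)` are algebraic (`ChernCharacterBetti.ch_mem_algebraicClasses`), hence of types `(1,1)`,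
`(2,2)`; `ch₁ ∪ ch₁` is of type `(2,2)`; and `H^{2,2}` is a subspace. -/
theorem isOfHodgeType_kappaClass (hGr : Grothendieck1969_supportedClasses_le_hodgeConiveau)
    {W : Motives.SchemeOver ℂ} (hW : Motives.IsSmoothProjective n W) (B : HodgeModel n W)
    (hcB : CupPreservesHodgeType n W) (G : W.left.Modules) (hG : Motives.IsVectorBundle G) (r : ℕ) :
    IsOfHodgeType n W (2 * 2) 2 2 (cupProduct (rfl : 2 * 1 + 2 * 1 = 2 * 2) (C.ch W G 1) (C.ch W G 1) -
      (2 * (r : ℂ)) • C.ch W G 2) := by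
  have h1 : IsOfHodgeType n W (2 * 1) 1 1 (C.ch W G 1) :=
    isOfHodgeType_of_mem_algebraicClasses hGr hW B (C.ch_mem_algebraicClasses hW G hG 1)
  have h2 : IsOfHodgeType n W (2 * 2) 2 2 (C.ch W G 2) :=
    isOfHodgeType_of_mem_algebraicClasses hGr hW B (C.ch_mem_algebraicClasses hW G hG 2)
  have h11 : IsOfHodgeType n W (2 * 2) (1 + 1) (1 + 1)
      (cupProduct (rfl : 2 * 1 + 2 * 1 = 2 * 2) (C.ch W G 1) (C.ch W G 1)) :=
    hcB _ h1 h1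
  exact isOfHodgeType_sub hW h11 (isOfHodgeType_smul h2 _)

end Kappa

/-! ### The two halves of the stub, and the core -/

/-- **S2 (i), unconditionally: the intertwiner action is rational up to ONE non-zero scalar.**
For every orientation family `μ` with Poincaré duality, every Chern character `C`, projective K3
surfaces `X, Y` and a vector bundle `G` of rank `r` on `X ⊗ Y`, there is `c ∈ ℂ`, `c ≠ 0`, with
`c • fst_*(snd^* y ∪ κ_G)` rational for every rational `y ∈ H²(Y(ℂ); ℂ)`
(`exists_smul_corrAction_isRationalClass` with `isRationalClass_kappaClass`; the scalar absorbs the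
orientation family, cf. `complexGysin_eq_smul_of_orientationFamily`). -/
theorem kappaAction_rational (μ : OrientationFamily) (hμ : μ.HasPoincareDuality)
    (C : ChernCharacterBetti) (X Y : Motives.SchemeOver ℂ) (hX : Surfaces.IsK3Surface X)
    (hY : Surfaces.IsK3Surface Y) (G : (MonoidalCategoryStruct.tensorObj X Y).left.Modules) (r : ℕ)
    (hG : Motives.IsVectorBundle G) :
    ∃ c : ℂ, c ≠ 0 ∧ ∀ y, IsRationalClass y →
      IsRationalClass (c • complexGysin μ (Motives.IsSmoothProjective.tensor_holds hX.1 hY.1) hX.1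
        (SemiCartesianMonoidalCategory.fst X Y) (rfl : 2 * 1 + 2 * 2 + 2 * 2 = 2 * 1 + 2 * (2 + 2))
        (cupProduct (rfl : 2 * 1 + 2 * 2 = 2 * 1 + 2 * 2)
          (complexBetti.map (SemiCartesianMonoidalCategory.snd X Y) (2 * 1) y)
          (cupProduct (rfl : 2 * 1 + 2 * 1 = 2 * 2) (C.ch (MonoidalCategoryStruct.tensorObj X Y) G 1)
              (C.ch (MonoidalCategoryStruct.tensorObj X Y) G 1) -
            (2 * (r : ℂ)) • C.ch (MonoidalCategoryStruct.tensorObj X Y) G 2))) :=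
  exists_smul_corrAction_isRationalClass μ hμ hX.1 hY.1 (e := 2) (a := 2 * 1) (b := 2 * 1) rfl
    (isRationalClass_kappaClass C _ G hG r)

/-- **S2 (ii) with explicit analytic inputs: the intertwiner action preserves Hodge types.** For
projective K3 surfaces `X, Y`, a Hodge model `B` of the fourfold `X ⊗ Y` with cup products adding
Hodge types on `X ⊗ Y` and on `X`, and `Grothendieck1969_supportedClasses_le_hodgeConiveau`: if
`y ∈ H²(Y(ℂ))` is of type `(i, j)` then `fst_*(snd^* y ∪ κ_G) ∈ H²(X(ℂ))` is of type `(i, j)`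
(`κ_G` is of type `(2,2)`, `snd^* y ∪ κ_G` of type `(i+2, j+2)` in `H⁶`, and `fst_*` has bidegree
`(−2, −2)`). -/
theorem kappaAction_hodgeType_of_hodgeModel (hGr : Grothendieck1969_supportedClasses_le_hodgeConiveau)
    (μ : OrientationFamily) (C : ChernCharacterBetti) (X Y : Motives.SchemeOver ℂ)
    (hX : Surfaces.IsK3Surface X) (hY : Surfaces.IsK3Surface Y)
    (B : HodgeModel (2 + 2) (MonoidalCategoryStruct.tensorObj X Y))
    (hcB : CupPreservesHodgeType (2 + 2) (MonoidalCategoryStruct.tensorObj X Y))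
    (hcX : CupPreservesHodgeType 2 X)
    (G : (MonoidalCategoryStruct.tensorObj X Y).left.Modules) (r : ℕ) (hG : Motives.IsVectorBundle G)
    (i j : ℕ) (y : complexBetti Y (2 * 1)) (hy : IsOfHodgeType 2 Y (2 * 1) i j y) :
    IsOfHodgeType 2 X (2 * 1) i j (complexGysin μ (Motives.IsSmoothProjective.tensor_holds hX.1 hY.1) hX.1
        (SemiCartesianMonoidalCategory.fst X Y) (rfl : 2 * 1 + 2 * 2 + 2 * 2 = 2 * 1 + 2 * (2 + 2))
        (cupProduct (rfl : 2 * 1 + 2 * 2 = 2 * 1 + 2 * 2)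
          (complexBetti.map (SemiCartesianMonoidalCategory.snd X Y) (2 * 1) y)
          (cupProduct (rfl : 2 * 1 + 2 * 1 = 2 * 2) (C.ch (MonoidalCategoryStruct.tensorObj X Y) G 1)
              (C.ch (MonoidalCategoryStruct.tensorObj X Y) G 1) -
            (2 * (r : ℂ)) • C.ch (MonoidalCategoryStruct.tensorObj X Y) G 2))) := by
  obtain ⟨A⟩ := hX.nonempty_hodgeModel
  exact isOfHodgeType_corrAction μ hX.1 hY.1 B A hcB hcX (e := 2) (a := 2 * 1) (b := 2 * 1) rfl
    (isOfHodgeType_kappaClass C hGr (Motives.IsSmoothProjective.tensor_holds hX.1 hY.1) B hcB G hG r)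
    (p := i) (q := j) (by omega) (by omega) hy

/-- **S2 (ii) from named facts of the tree**: `nonempty_hodgeModel` (Hodge models of all smooth
projective varieties; used for the fourfold `X ⊗ Y`), de Rham's theorem in multiplicative form
`exists_deRhamIsoFamily` for all finite-dimensional complex model spaces (through
`cupPreservesHodgeType_of_nonempty_hodgeModel` on `X ⊗ Y` and `cupPreservesHodgeType_of_exists_deRhamIsoFamily`
on the K3 Hodge model of `X`), in the binder shape of `isOfHodgeType_complexGysin`, and
`Grothendieck1969_supportedClasses_le_hodgeConiveau` (algebraic classes are of type `(p, p)`);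
`nonempty_hodgeModel` is invoked at the fourfold `X ⊗ Y` only. -/
theorem kappaAction_hodgeType_of_facts
    (hM : ∀ (m : ℕ) (Y : Motives.SchemeOver ℂ), nonempty_hodgeModel m Y)
    (hdR : ∀ (E : Type) [NormedAddCommGroup E] [NormedSpace ℂ E] [FiniteDimensional ℂ E],
      exists_deRhamIsoFamily 𝓘(ℝ, E))
    (hGr : Grothendieck1969_supportedClasses_le_hodgeConiveau)
    (μ : OrientationFamily) (C : ChernCharacterBetti) (X Y : Motives.SchemeOver ℂ)
    (hX : Surfaces.IsK3Surface X) (hY : Surfaces.IsK3Surface Y)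
    (G : (MonoidalCategoryStruct.tensorObj X Y).left.Modules) (r : ℕ) (hG : Motives.IsVectorBundle G)
    (i j : ℕ) (y : complexBetti Y (2 * 1)) (hy : IsOfHodgeType 2 Y (2 * 1) i j y) :
    IsOfHodgeType 2 X (2 * 1) i j (complexGysin μ (Motives.IsSmoothProjective.tensor_holds hX.1 hY.1) hX.1
        (SemiCartesianMonoidalCategory.fst X Y) (rfl : 2 * 1 + 2 * 2 + 2 * 2 = 2 * 1 + 2 * (2 + 2))
        (cupProduct (rfl : 2 * 1 + 2 * 2 = 2 * 1 + 2 * 2)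
          (complexBetti.map (SemiCartesianMonoidalCategory.snd X Y) (2 * 1) y)
          (cupProduct (rfl : 2 * 1 + 2 * 1 = 2 * 2) (C.ch (MonoidalCategoryStruct.tensorObj X Y) G 1)
              (C.ch (MonoidalCategoryStruct.tensorObj X Y) G 1) -
            (2 * (r : ℂ)) • C.ch (MonoidalCategoryStruct.tensorObj X Y) G 2))) := by
  have hI := hodgePQ_independent_of_hodgeModel_holds
  have hW := Motives.IsSmoothProjective.tensor_holds hX.1 hY.1
  -- the fact `nonempty_hodgeModel` is used at the fourfold `X ⊗ Y` only; `X` has its K3 Hodge model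
  obtain ⟨A⟩ := hX.nonempty_hodgeModel
  exact kappaAction_hodgeType_of_hodgeModel hGr μ C X Y hX hY ((hM _ _).nonempty hW).some
    (cupPreservesHodgeType_of_nonempty_hodgeModel hI (hM _ _) hdR hW)
    (cupPreservesHodgeType_of_exists_deRhamIsoFamily hI hX.1 A (hdR A.model)) G r hG i j y hy

/-- **The unfolded CORE of `stub_kappaActionHodge`, conditional on the named facts
`nonempty_hodgeModel`, `exists_deRhamIsoFamily`, `Grothendieck1969_supportedClasses_le_hodgeConiveau`.**
For every orientation family `μ` with Poincaré duality, every Chern character `C`, projective K3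
surfaces `X, Y` and every vector bundle `G` of rank `r` on `X ⊗ Y`, the action
`y ↦ fst_*(snd^* y ∪ κ_G)`, `κ_G = ch₁(G) ∪ ch₁(G) − 2r·ch₂(G)`, of the intertwiner class on `H²`
(i) is rational up to one non-zero scalar (unconditional, `kappaAction_rational`) and (ii) preserves
Hodge types `(i, j)` (`kappaAction_hodgeType_of_facts`). The registered stub follows by
`intro …; exact h …` (lead scratch `SkeletonCoresTest`). -/
theorem kappaActionHodge_core_of_facts
    (hM : ∀ (m : ℕ) (Y : Motives.SchemeOver ℂ), nonempty_hodgeModel m Y)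
    (hdR : ∀ (E : Type) [NormedAddCommGroup E] [NormedSpace ℂ E] [FiniteDimensional ℂ E],
      exists_deRhamIsoFamily 𝓘(ℝ, E))
    (hGr : Grothendieck1969_supportedClasses_le_hodgeConiveau) :
    ∀ (μ : OrientationFamily), μ.HasPoincareDuality → ∀ (C : ChernCharacterBetti)
      (X Y : Motives.SchemeOver ℂ) (hX : Surfaces.IsK3Surface X) (hY : Surfaces.IsK3Surface Y)
      (G : (MonoidalCategoryStruct.tensorObj X Y).left.Modules) (r : ℕ),
      Motives.IsVectorBundle G →
      (∃ c : ℂ, c ≠ 0 ∧ ∀ y, IsRationalClass y →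
        IsRationalClass (c • complexGysin μ (Motives.IsSmoothProjective.tensor_holds hX.1 hY.1) hX.1
          (SemiCartesianMonoidalCategory.fst X Y) (rfl : 2 * 1 + 2 * 2 + 2 * 2 = 2 * 1 + 2 * (2 + 2))
          (cupProduct (rfl : 2 * 1 + 2 * 2 = 2 * 1 + 2 * 2)
            (complexBetti.map (SemiCartesianMonoidalCategory.snd X Y) (2 * 1) y)
            (cupProduct (rfl : 2 * 1 + 2 * 1 = 2 * 2) (C.ch (MonoidalCategoryStruct.tensorObj X Y) G 1)
                (C.ch (MonoidalCategoryStruct.tensorObj X Y) G 1) -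
              (2 * (r : ℂ)) • C.ch (MonoidalCategoryStruct.tensorObj X Y) G 2)))) ∧
      (∀ (i j : ℕ) y, IsOfHodgeType 2 Y (2 * 1) i j y →
        IsOfHodgeType 2 X (2 * 1) i j (complexGysin μ (Motives.IsSmoothProjective.tensor_holds hX.1 hY.1) hX.1
          (SemiCartesianMonoidalCategory.fst X Y) (rfl : 2 * 1 + 2 * 2 + 2 * 2 = 2 * 1 + 2 * (2 + 2))
          (cupProduct (rfl : 2 * 1 + 2 * 2 = 2 * 1 + 2 * 2)
            (complexBetti.map (SemiCartesianMonoidalCategory.snd X Y) (2 * 1) y)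
            (cupProduct (rfl : 2 * 1 + 2 * 1 = 2 * 2) (C.ch (MonoidalCategoryStruct.tensorObj X Y) G 1)
                (C.ch (MonoidalCategoryStruct.tensorObj X Y) G 1) -
              (2 * (r : ℂ)) • C.ch (MonoidalCategoryStruct.tensorObj X Y) G 2)))) := by
  intro μ hμ C X Y hX hY G r hG
  exact ⟨kappaAction_rational μ hμ C X Y hX hY G r hG,
    fun i j y hy ↦ kappaAction_hodgeType_of_facts hM hdR hGr μ C X Y hX hY G r hG i j y hy⟩

/-! ### The registered sub-goal stub (one line, self-contained: matched by name + signature) -/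

/-- **Registered stub `stub_kappaActionHodgeOfFacts`** (crux item stmt-HodgeConjecture-14464, line
`neron-severi-intertwiner`; sub-goal standing in for the skeleton stub `stub_kappaActionHodge`, whose registered
signature is phrased with the skeleton's LOCAL `corrAction`/`kappaClass` and is therefore not provable by name from
a tree file): the unfolded core of S2 — for projective K3 surfaces `X, Y`, a Chern character `C` and a vector
bundle `G` of rank `r` on `X ⊗ Y`, the action `y ↦ fst_*(snd^* y ∪ κ_G)` of `κ_G = ch₁(G) ∪ ch₁(G) − 2r·ch₂(G)`
on `H²` is rational up to one non-zero scalar and preserves Hodge types `(i, j)` — GRANTED the named facts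
`nonempty_hodgeModel` (all smooth projective varieties; used at the fourfold `X ⊗ Y`), de Rham's theorem
`exists_deRhamIsoFamily` (all finite-dimensional complex model spaces; `modelWithCornersSelf ℝ E` is
`𝓘(ℝ, E)` spelled without the scoped notation) and `Grothendieck1969_supportedClasses_le_hodgeConiveau`.
This is `kappaActionHodge_core_of_facts`; the skeleton stub follows from it by `intro …; exact …`
(`corrAction`, `kappaClass` unfold by `rfl`). -/
theorem stub_kappaActionHodgeOfFacts : open CategoryTheory Literature.AlgebraicGeometry Literature.AlgebraicGeometry.HodgeTheory Literature.AlgebraicTopology.SingularHomology in (∀ (m : ℕ) (Y : Motives.SchemeOver ℂ), nonempty_hodgeModel m Y) → (∀ (E : Type) [NormedAddCommGroup E] [NormedSpace ℂ E] [FiniteDimensional ℂ E], Literature.NumberTheory.Transcendental.exists_deRhamIsoFamily (modelWithCornersSelf ℝ E)) → Grothendieck1969_supportedClasses_le_hodgeConiveau → ∀ (μ : OrientationFamily), μ.HasPoincareDuality → ∀ (C : ChernCharacterBetti) (X Y : Motives.SchemeOver ℂ) (hX : Surfaces.IsK3Surface X) (hY : Surfaces.IsK3Surface Y) (G : (MonoidalCategoryStruct.tensorObj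 X Y).left.Modules) (r : ℕ), Motives.IsVectorBundle G → (∃ c : ℂ, c ≠ 0 ∧ ∀ y, IsRationalClass y → IsRationalClass (c • complexGysin μ (Motives.IsSmoothProjective.tensor_holds hX.1 hY.1) hX.1 (SemiCartesianMonoidalCategory.fst X Y) (rfl : 2 * 1 + 2 * 2 + 2 * 2 = 2 * 1 + 2 * (2 + 2)) (cupProduct (rfl : 2 * 1 + 2 * 2 = 2 * 1 + 2 * 2) (complexBetti.map (SemiCartesianMonoidalCategory.snd X Y) (2 * 1) y) (cupProduct (rfl : 2 * 1 + 2 * 1 = 2 * 2) (C.ch (MonoidalCategoryStruct.tensorObj X Y) G 1) (C.ch (MonoidalCategoryStruct.tensorObj X Y) G 1) - (2 * (r : ℂ)) • C.ch (MonoidalCategoryStruct.tensorObj X Y) G 2)))) ∧ (∀ (i j : ℕ) y, IsOfHodgeType 2 Y (2 * 1) i j y → IsOfHodgeType 2 X (2 * 1) i j (complexGysin μ (Motives.IsSmoothProjective.tensor_holds hX.1 hY.1) hX.1 (SemiCartesianMonoidalCategory.fst X Y) (rfl : 2 * 1 + 2 * 2 + 2 * 2 = 2 * 1 + 2 * (2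 + 2)) (cupProduct (rfl : 2 * 1 + 2 * 2 = 2 * 1 + 2 * 2) (complexBetti.map (SemiCartesianMonoidalCategory.snd X Y) (2 * 1) y) (cupProduct (rfl : 2 * 1 + 2 * 1 = 2 * 2) (C.ch (MonoidalCategoryStruct.tensorObj X Y) G 1) (C.ch (MonoidalCategoryStruct.tensorObj X Y) G 1) - (2 * (r : ℂ)) • C.ch (MonoidalCategoryStruct.tensorObj X Y) G 2)))) :=
  kappaActionHodge_core_of_facts

end Summit.HodgeConjecture.HodgeConjecture.Theorems.NikulinSerreCarrier.NeronSeveriIntertwiner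

end
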